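import Summits.ResolutionOfSingularities.ResolutionOfSingularities.Theorems.CossartPiltant2019PrincipalizationHolds
import Literature.AlgebraicGeometry.CossartPiltant200819.Cor46Cofinality2008
import Literature.AlgebraicGeometry.CossartPiltant200819.Prop48RegularCentres2008
import Literature.AlgebraicGeometry.CossartPiltant200819.ClimbToInertiaField2008
import HarnessLib

/-!
# Cossart–Piltant 2008 corollaries of principalization HOLD (Cor. 4.6, Prop. 4.8, Cor. 6.3), by name from F-77

OURS (res-inputs-p-8a g2; critic R148 (3), plan-1 allocation l.81717). V. Cossart, O. Piltant, J. Algebra 320 (2008):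
Cor. 4.6 (cofinality of local uniformizations), Prop. 4.8 (elimination of regular fundamental points), Cor. 6.3 (climb to the
inertia field) [cite: CossartPiltant2008, Cor. 4.6, Prop. 4.8, Cor. 6.3]. The tree holds each as a named fact
(`CP2008.Cofinality`, `CP2008.EliminationOfRegularFundamentalPoints`, `CP2008.ClimbToInertiaField`, and the twin
`CP2008.CofinalityOfLocalUniformizations`) together with a PROVED reduction from principalization
(`CP2008.cofinality_of_principalization`, `CP2008.cofinalityOfLocalUniformizations_of_principalization`,
`CP2008.eliminationOfRegularFundamentalPoints_of_principalization`, `CP2008.climbToInertiaField_of_principalization`); this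
file applies them to the tree theorem `CP2008Prop44.CossartPiltant2019Principalization_holds` (F-77, from F-71). Four
one-liners; nothing else is claimed. AI-written; AI review weaker than expert review. What is proved = the TREE's typed
statements named above; local uniformization, CP 2019 Thm. 1.1, resolution in dimension `≥ 4` / positive characteristic are
NOT proved; no statement of a manuscript under adjudication is proved.
-/

-- `Summit.<Summit>.<Sub>.Theorems` with `Sub = Summit` (single-conjunct summit, D-0017)
set_option linter.dupNamespace false

noncomputable section

open Literature.AlgebraicGeometry.Resolution
open Literature.AlgebraicGeometry.CossartPiltant200819

namespace Summit.ResolutionOfSingularities.ResolutionOfSingularities.Theorems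

namespace CP2008Prop44

universe u

/-- **P3: [CoP1] Cor. 4.6 — `CP2008.Cofinality` HOLDS**, from F-77 by `CP2008.cofinality_of_principalization`.
[cite: CossartPiltant2008, Cor. 4.6] -/
theorem Cofinality_holds : CP2008.Cofinality.{u} :=
  CP2008.cofinality_of_principalization CossartPiltant2019Principalization_holds

/-- **P3′: the local-uniformization form `CP2008.CofinalityOfLocalUniformizations` HOLDS**, from F-77 by
`CP2008.cofinalityOfLocalUniformizations_of_principalization`. [cite: CossartPiltant2008, Cor. 4.6] -/
theorem CofinalityOfLocalUniformizations_holds : CP2008.CofinalityOfLocalUniformizations.{u} :=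
  CP2008.cofinalityOfLocalUniformizations_of_principalization CossartPiltant2019Principalization_holds

/-- **P4: [CoP1] Prop. 4.8 — `CP2008.EliminationOfRegularFundamentalPoints` HOLDS**, from F-77 by
`CP2008.eliminationOfRegularFundamentalPoints_of_principalization`. [cite: CossartPiltant2008, Prop. 4.8] -/
theorem EliminationOfRegularFundamentalPoints_holds : CP2008.EliminationOfRegularFundamentalPoints.{u} :=
  CP2008.eliminationOfRegularFundamentalPoints_of_principalization CossartPiltant2019Principalization_holds

/-- **P5: [CoP1] Cor. 6.3 — `CP2008.ClimbToInertiaField` HOLDS**, from F-77 by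
`CP2008.climbToInertiaField_of_principalization`. [cite: CossartPiltant2008, Cor. 6.3] -/
theorem ClimbToInertiaField_holds : CP2008.ClimbToInertiaField.{u} :=
  CP2008.climbToInertiaField_of_principalization CossartPiltant2019Principalization_holds

end CP2008Prop44

end Summit.ResolutionOfSingularities.ResolutionOfSingularities.Theorems

end
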